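import Mathlib
import Summits.ResolutionOfSingularities.ResolutionOfSingularities.Theorems.PAlterationPicoverLocalModelLocalChartsWoundCentre
import Summits.ResolutionOfSingularities.ResolutionOfSingularities.Theorems.PAlterationPicoverPointDataPointwise
import HarnessLib

/-!
# Crux `Picover` (stmt-ResolutionOfSingularities-0554), line `giraud-separated-base` — endgame,
# local charts of the normalised cover: the chart at a point over a wound/transversal centre

Stub `localChartSep_woundCentre` (wave 5, U4) of the registered stub `stub_localChartsSep`.

**Setting.** `W'` a regular integral scheme locally of finite type over a field `k` of
characteristic `p`, `E` an snc boundary on `W'`, `U₀ ⊆ W'` an affine open and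
`a ∈ Γ(W', U₀)` a section whose germ at every point of `U₀` is in Giraud normal form along
`E`; `g : Z → W'` a morphism from an integral scheme (in the application, the normalisation of
`W'` in a purely inseparable extension of degree `p` of its function field) which, over every
affine `V ⊆ U₀` with `g⁻¹V ≠ ∅`, carries the "uniform sections package": `g⁻¹V` is affine,
`B = Γ(Z, g⁻¹V)` is integrally closed and integral over `A = Γ(W', V)` with injective structure
map, and every element of `B` is, up to a non-zero denominator from `A`, a polynomial over `A`
in a `p`-th root `t ∈ B` of `a|_V`.

**Claim.** At a point `y ∈ Z` whose image `w = g(y) ∈ U₀` is a wound/transversal centre of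
the normal form (`a_w = g₀^p + (∏ x_j^{B_j})^p u₀` with `u₀` wound or a transversal parameter,
`x_j` generators of the stalk ideals of the components of `E` through `w`), there is a local
log-regular chart of `Z` at `y` (Kato's condition (2.1) at every prime of the chart ring) whose
stalk monoids are the divisorial monoids of the pulled-back boundary
`(∏_{D ∈ E} D_{g(y')}) 𝒪_{Z,y'}`.

**Proof.** This is `PicoverLocalModel.LocalCharts.localChart_woundCentre` (crux 0557) for an
abstract cover: spread the centre data to an affine open `U ∋ w` contained in `U₀`
(`exists_affineOpen_spread_le`: `exists_affineOpen_spread` followed by a basic-open shrinking,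
so that `a` restricts to `aU ∈ Γ(W', U)`), take `V = g⁻¹U`, the sections package over `U`,
and the orthant chart `ℕ^r → Γ(Z, V)`, `v ↦ ∏ xs_j^{v_j}`; Kato's condition at every prime of
`Γ(Z, V)` and the stalk monoids at every point of `V` follow from
`localChart_pointwise_orthant`, the Giraud normal form at the other points of `U` being read
off the pointwise hypothesis by
`Picover.PointDataPointwise.pointData_giraudNormalFormAt_of_pointwise`.
-/

noncomputable section

-- single-problem summit: the doubled namespace component `ResolutionOfSingularities` is the tree layout
set_option linter.dupNamespace false

open CategoryTheory AlgebraicGeometry TopologicalSpace Polynomial IsLocalRing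
open Literature.AlgebraicGeometry.Resolution
open Summit.ResolutionOfSingularities.ResolutionOfSingularities.Theorems.PicoverLocalModel.LocalCharts
open Summit.ResolutionOfSingularities.ResolutionOfSingularities.Theorems.Picover.PointDataPointwise

namespace Summit.ResolutionOfSingularities.ResolutionOfSingularities.Theorems.Picover.LocalChartSepWoundCentre

universe u

/-- **Spreading boundary equations and germs to an affine neighbourhood inside a given open.**
`exists_affineOpen_spread` followed by shrinking to a basic open neighbourhood `D(h)` of the
point inside `U₀`: the spread sections restrict, the boundary ideals restrict
(`Scheme.IdealSheafData.map_ideal`), and the prime principal ideals `(g_j)` stay prime in the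
localization `Γ(X, U₁)_h = Γ(X, D(h))` because `h ∉ (g_j)` (the germ of `h` at the point is a
unit, that of `g_j` is not). [folklore] -/
theorem exists_affineOpen_spread_le {X : Scheme.{u}} [IsIntegral X] [IsLocallyNoetherian X]
    (E : List X.IdealSheafData) (x : X) {r : ℕ}
    (D : Fin r → {D : X.IdealSheafData // D ∈ E ∧ x ∈ D.support})
    (hDsurj : ∀ D' ∈ E, x ∈ D'.support → ∃ j, (D j).1 = D')
    (g : Fin r → X.presheaf.stalk x) (hg : ∀ j, stalkIdeal (D j).1 x = Ideal.span {g j})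
    (hgprime : ∀ j, (Ideal.span {g j}).IsPrime)
    {m : ℕ} (f : Fin m → X.presheaf.stalk x) (U₀ : X.Opens) (hxU₀ : x ∈ U₀) :
    ∃ (U : X.affineOpens) (hxU : x ∈ (U : X.Opens)) (_ : (U : X.Opens) ≤ U₀)
      (gs : Fin r → Γ(X, (U : X.Opens))) (fs : Fin m → Γ(X, (U : X.Opens))),
      (∀ j, X.presheaf.germ (U : X.Opens) x hxU (gs j) = g j) ∧
      (∀ k, X.presheaf.germ (U : X.Opens) x hxU (fs k) = f k) ∧
      (∀ j, (D j).1.ideal U = Ideal.span {gs j}) ∧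
      (∀ D' ∈ E, (∀ j, (D j).1 ≠ D') → D'.ideal U = ⊤) ∧
      (∀ j, (Ideal.span {gs j}).IsPrime) := by
  obtain ⟨U₁, hx₁, g₁, f₁, -, hg₁, hf₁, -, -, hB1, hB2, hprime⟩ :=
    exists_affineOpen_spread E x D hDsurj g hg hgprime f ![] (fun k => k.elim0)
  -- a basic open neighbourhood of `x` inside `U₁ ⊓ U₀`
  obtain ⟨h, hle, hxh⟩ := U₁.2.exists_basicOpen_le (V := (U₁ : X.Opens) ⊓ U₀)
    ⟨x, Opens.mem_inf.mpr ⟨hx₁, hxU₀⟩⟩ hx₁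
  let U : X.affineOpens := ⟨X.basicOpen h, U₁.2.basicOpen h⟩
  have hUU₁ : (U : X.Opens) ≤ U₁ := X.basicOpen_le h
  have hUU₀ : (U : X.Opens) ≤ U₀ := hle.trans inf_le_right
  haveI hloc : IsLocalization.Away h Γ(X, (U : X.Opens)) := U₁.2.isLocalization_basicOpen h
  have hres : ∀ s : Γ(X, (U₁ : X.Opens)),
      algebraMap Γ(X, (U₁ : X.Opens)) Γ(X, (U : X.Opens)) s = X.presheaf.map (homOfLE hUU₁).op s :=
    fun s => rfl
  -- `h ∉ (g₁ j)`: the germ of `h` at `x` is a unit, that of `g₁ j` is not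
  have hdisj : ∀ j, Disjoint (Submonoid.powers h : Set Γ(X, (U₁ : X.Opens))) (Ideal.span {g₁ j}) := by
    intro j
    rw [Set.disjoint_left]
    rintro _ ⟨n, rfl⟩ hmem
    have hh : h ∈ Ideal.span {g₁ j} := (hprime j).mem_of_pow_mem n hmem
    obtain ⟨c, hc⟩ := Ideal.mem_span_singleton'.mp hh
    have hu : IsUnit (X.presheaf.germ (U₁ : X.Opens) x hx₁ h) := (X.mem_basicOpen h x hx₁).mp hxh
    rw [← hc, map_mul, hg₁] at hu
    exact (hgprime j).ne_top (Ideal.eq_top_of_isUnit_mem _ (Ideal.mem_span_singleton_self _)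
      (isUnit_of_mul_isUnit_right hu))
  refine ⟨U, hxh, hUU₀, fun j => X.presheaf.map (homOfLE hUU₁).op (g₁ j),
    fun k => X.presheaf.map (homOfLE hUU₁).op (f₁ k), fun j => ?_, fun k => ?_, fun j => ?_,
    fun D' hD' hne => ?_, fun j => ?_⟩
  · rw [germ_map_homOfLE, hg₁]
  · rw [germ_map_homOfLE, hf₁]
  · rw [← (D j).1.map_ideal hUU₁, hB1 j, Ideal.map_span, Set.image_singleton]
    rfl
  · rw [← D'.map_ideal hUU₁, hB2 D' hD' hne, Ideal.map_top]
  · have heq : Ideal.span {X.presheaf.map (homOfLE hUU₁).op (g₁ j)} =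
        (Ideal.span {g₁ j}).map (algebraMap Γ(X, (U₁ : X.Opens)) Γ(X, (U : X.Opens))) := by
      rw [Ideal.map_span, Set.image_singleton, hres]
    rw [heq]
    exact IsLocalization.isPrime_of_isPrime_disjoint (Submonoid.powers h) Γ(X, (U : X.Opens)) _
      (hprime j) (hdisj j)

/-- **The local chart at a point over a wound/transversal centre, for an abstract cover with a
uniform sections package.** See the module docstring. [cite: Kato1994, Def. (2.1) and Thm. 11.6] -/
theorem localChartSep_woundCentre : ∀ (p : ℕ) [Fact p.Prime] (k : Type) [Field k] [CharP k p] (W' : Scheme.{0}) (f' : W' ⟶ Spec (.of k)) [LocallyOfFiniteType f'] [IsIntegral W'], Scheme.IsRegular W' → ∀ (E : List W'.IdealSheafData), HasSNC E → ∀ (U₀ : W'.affineOpens) (a : Γ(W', (U₀ : W'.Opens))), (∀ (w'' : W') (hw'' : w'' ∈ (U₀ : W'.Opens)), ∃ (r : ℕ) (D : Fin r → {D : W'.IdealSheafData // D ∈ E ∧ w'' ∈ D.support}) (x : Fin r → W'.presheaf.stalk w''), Function.Bijective D ∧ (∀ j, stalkIdeal (D j).1 w'' = Ideal.span {x j}) ∧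 GiraudNormalFormAt p x (W'.presheaf.germ (U₀ : W'.Opens) w'' hw'' a)) → ∀ (Z : Scheme.{0}) [IsIntegral Z] (g : Z ⟶ W'), (∀ (V : W'.affineOpens) (hV : (V : W'.Opens) ≤ U₀), Nonempty (g ⁻¹ᵁ (V : W'.Opens)) → IsAffineOpen (g ⁻¹ᵁ (V : W'.Opens)) ∧ IsIntegrallyClosed Γ(Z, g ⁻¹ᵁ (V : W'.Opens)) ∧ (g.app (V : W'.Opens)).hom.IsIntegral ∧ Function.Injective (g.app (V : W'.Opens)) ∧ ∃ t : Γ(Z, g ⁻¹ᵁ (V : W'.Opens)), t ^ p = g.app (V : W'.Opens) (W'.presheaf.map (homOfLE hV).op a) ∧ ∀ z : Γ(Z, g ⁻¹ᵁ (V : W'.Opens)), ∃ d : Γ(W', (V : W'.Opens)), d ≠ 0 ∧ ∃ P : Γ(W', (V : W'.Opens))[X], g.app (V : W'.Opens) d * z = P.eval₂ (g.app (V : W'.Opens)).hom t) → ∀ (y : Z) (w : W') (hw : g.base y = w) (hwU₀ : w ∈ (U₀ : W'.Opens)) {r : ℕ} (D : Fin r → {D : W'.IdealSheafData // D ∈ E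 ∧ w ∈ D.support}) (x : Fin r → W'.presheaf.stalk w), Function.Bijective D → (∀ j, stalkIdeal (D j).1 w = Ideal.span {x j}) → ∀ (g₀ u₀ : W'.presheaf.stalk w) (Bexp : Fin r → ℕ), IsWoundOrTransversalAt p x u₀ → W'.presheaf.germ (U₀ : W'.Opens) w hwU₀ a = g₀ ^ p + (∏ j, x j ^ Bexp j) ^ p * u₀ → Nonempty (LocalLogRegularChart Z (fun y => divisorialMonoid (((E.map fun D => stalkIdeal D (g.base y))).prod.map (g.stalkMap y).hom)) y) := by
  intro p _ k _ _ W' f' _ _ hreg E hE U₀ a hG Z _ g hsecZ y w hw hwU₀ r D x hDbij hDgen g₀ u₀ Bexp hwt₀ ha₀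
  classical
  haveI : IsLocallyNoetherian W' := LocallyOfFiniteType.isLocallyNoetherian f'
  -- the centre
  haveI hregw : IsRegularLocalRing (W'.presheaf.stalk w) := hreg w
  haveI := isDomain_of_isRegularLocalRing (W'.presheaf.stalk w)
  obtain ⟨hxm, hli⟩ := hli_of_hasSNC hE w D hDbij.1 x hDgen
  have hxprime : ∀ j, (Ideal.span {x j}).IsPrime := RegularParameters.isPrime_span_singleton hxm hli
  -- spread to an affine open `w ∈ U ⊆ U₀`
  obtain ⟨U, hwU, hUU₀, xs, fs, hxs, hfs, hB1, hB2, hprime⟩ :=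
    exists_affineOpen_spread_le E w D (fun D' hD' hsupp => hDbij.2 ⟨D', hD', hsupp⟩ |>.imp
      fun j hj => congrArg Subtype.val hj) x hDgen hxprime ![g₀, u₀] (U₀ : W'.Opens) hwU₀
  set gs := fs 0 with hgs
  set uw := fs 1 with huw
  -- sections of the cover over `U`
  have hyV : y ∈ g ⁻¹ᵁ (U : W'.Opens) := by
    change g.base y ∈ (U : W'.Opens); rw [hw]; exact hwU
  obtain ⟨hVaff, hic, hint, hinj, t, ht, hbir⟩ := hsecZ U hUU₀ ⟨⟨y, hyV⟩⟩
  -- the radicand on `U`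
  set aU : Γ(W', (U : W'.Opens)) := W'.presheaf.map (homOfLE hUU₀).op a with haU
  have hgerm_aU : ∀ (w'' : W') (hw'' : w'' ∈ (U : W'.Opens)),
      W'.presheaf.germ (U : W'.Opens) w'' hw'' aU =
        W'.presheaf.germ (U₀ : W'.Opens) w'' (hUU₀ hw'') a :=
    fun w'' hw'' => germ_map_homOfLE hUU₀ w'' hw'' a
  -- the pointwise Giraud normal form of `aU` on `U`
  have hG' : ∀ (w'' : W') (hw'' : w'' ∈ (U : W'.Opens)), ∃ (r' : ℕ)
      (D' : Fin r' → {D : W'.IdealSheafData // D ∈ E ∧ w'' ∈ D.support})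
      (x' : Fin r' → W'.presheaf.stalk w''), Function.Bijective D' ∧
      (∀ i, stalkIdeal (D' i).1 w'' = Ideal.span {x' i}) ∧
      GiraudNormalFormAt p x' (W'.presheaf.germ (U : W'.Opens) w'' hw'' aU) := fun w'' hw'' => by
    rw [hgerm_aU w'' hw'']
    exact hG w'' (hUU₀ hw'')
  -- the identity in `A = Γ(W', U)`
  have hA : aU = gs ^ p + (∏ j, xs j ^ Bexp j) ^ p * uw := by
    apply germ_injective_of_isIntegral (X := W') w hwU
    rw [hgerm_aU w hwU, ha₀, map_add, map_pow, map_mul, map_pow, map_prod]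
    simp only [map_pow, hxs, hgs, huw, hfs]
    rfl
  haveI : Nonempty (g ⁻¹ᵁ (U : W'.Opens)) := ⟨⟨y, hyV⟩⟩
  haveI : Nonempty (U : W'.Opens) := ⟨⟨w, hwU⟩⟩
  letI algAB : Algebra Γ(W', (U : W'.Opens)) Γ(Z, g ⁻¹ᵁ (U : W'.Opens)) := (g.app U).hom.toAlgebra
  have halg : ∀ s, algebraMap Γ(W', (U : W'.Opens)) Γ(Z, g ⁻¹ᵁ (U : W'.Opens)) s = g.app U s :=
    fun s => rfl
  haveI : Algebra.IsIntegral Γ(W', (U : W'.Opens)) Γ(Z, g ⁻¹ᵁ (U : W'.Opens)) := ⟨fun z => hint z⟩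
  haveI : IsIntegrallyClosed Γ(Z, g ⁻¹ᵁ (U : W'.Opens)) := hic
  have hinj' : Function.Injective (algebraMap Γ(W', (U : W'.Opens)) Γ(Z, g ⁻¹ᵁ (U : W'.Opens))) :=
    hinj
  haveI : CharP Γ(W', (U : W'.Opens)) p :=
    charP_of_injective_ringHom ((Scheme.ΓSpecIso (.of k)).inv ≫ f'.appLE ⊤ U le_top).hom.injective p
  have ht' : t ^ p = algebraMap _ _ aU := ht
  have hbir' : ∀ z : Γ(Z, g ⁻¹ᵁ (U : W'.Opens)), ∃ d : Γ(W', (U : W'.Opens)), d ≠ 0 ∧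
      ∃ P : Γ(W', (U : W'.Opens))[X], algebraMap _ _ d * z = aeval t P := by
    intro z; obtain ⟨d, hd, P, hP⟩ := hbir z; refine ⟨d, hd, P, ?_⟩; rw [aeval_def]; exact hP
  -- the orthant chart
  let Φ : Multiplicative (AddSubmonoid.nonneg (Fin r → ℤ)) →* Γ(Z, g ⁻¹ᵁ (U : W'.Opens)) :=
    { toFun := fun v => algebraMap Γ(W', (U : W'.Opens)) _
        (∏ j, xs j ^ (((Multiplicative.toAdd v).1) j).toNat)
      map_one' := by simp
      map_mul' := fun v v' => by
        rw [← map_mul, ← Finset.prod_mul_distrib]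
        congr 1
        refine Finset.prod_congr rfl fun j _ => ?_
        rw [← pow_add, ← Int.toNat_add ((Multiplicative.toAdd v).2 j) ((Multiplicative.toAdd v').2 j)]
        rfl }
  have hΦ : ∀ v : AddSubmonoid.nonneg (Fin r → ℤ), Φ (Multiplicative.ofAdd v) =
      algebraMap Γ(W', (U : W'.Opens)) _ (∏ j, xs j ^ ((v : Fin r → ℤ) j).toNat) := fun v => rfl
  -- data along `E`
  have hDE : ∀ j, (D j).1 ∈ E := fun j => (D j).2.1
  have hDinj : Function.Injective (fun j => (D j).1) := fun i j h => hDbij.1 (Subtype.ext h)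
  -- the centre as a localization of `A`
  letI := W'.presheaf.algebra_section_stalk (⟨w, hwU⟩ : (U : W'.Opens))
  haveI := U.2.isLocalization_stalk ⟨w, hwU⟩
  have hmem𝔮 : ∀ (w' : W') (hw' : w' ∈ (U : W'.Opens)) (s : Γ(W', (U : W'.Opens))),
      s ∈ (U.2.primeIdealOf ⟨w', hw'⟩).asIdeal ↔
        ¬ IsUnit (W'.presheaf.germ (U : W'.Opens) w' hw' s) := by
    intro w' hw' s
    letI := W'.presheaf.algebra_section_stalk (⟨w', hw'⟩ : (U : W'.Opens))
    haveI := U.2.isLocalization_stalk ⟨w', hw'⟩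
    rw [← IsLocalization.AtPrime.to_map_mem_maximal_iff (W'.presheaf.stalk w')
        (U.2.primeIdealOf ⟨w', hw'⟩).asIdeal s,
      IsLocalRing.mem_maximalIdeal, mem_nonunits_iff]
    rfl
  obtain ⟨hxm', hli₀⟩ := hli_of_hasSNC hE w D hDbij.1
    (fun j => W'.presheaf.germ (U : W'.Opens) w hwU (xs j))
    fun j => stalkIdeal_eq_span_germ_of_spread (D := fun j => (D j).1) hB1 hwU j
  have hx₀ : ∀ j, xs j ∈ (U.2.primeIdealOf ⟨w, hwU⟩).asIdeal := fun j =>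
    (hmem𝔮 w hwU _).mpr fun hu => (IsLocalRing.mem_maximalIdeal _).mp (hxm' j) hu
  have hwt₀' : IsWoundOrTransversalAt p
      (fun j => algebraMap Γ(W', (U : W'.Opens)) (W'.presheaf.stalk w) (xs j))
      (algebraMap Γ(W', (U : W'.Opens)) (W'.presheaf.stalk w) uw) := by
    have h1 : (fun j => algebraMap Γ(W', (U : W'.Opens)) (W'.presheaf.stalk w) (xs j)) = x :=
      funext fun j => hxs j
    have h2 : algebraMap Γ(W', (U : W'.Opens)) (W'.presheaf.stalk w) uw = u₀ := by
      rw [huw]; exact hfs 1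
    rw [h1, h2]; exact hwt₀
  -- Kato's condition and the stalk monoid at every point of `V`, via the local model
  have perPoint : ∀ (y' : Z) (hy' : y' ∈ g ⁻¹ᵁ (U : W'.Opens)) (N : Type) [CommRing N]
      [Algebra Γ(Z, g ⁻¹ᵁ (U : W'.Opens)) N]
      [IsLocalization.AtPrime N (hVaff.primeIdealOf ⟨y', hy'⟩).asIdeal],
      LogChart.IsLogRegularLocal (AddSubmonoid.nonneg (Fin r → ℤ))
        ((algebraMap Γ(Z, g ⁻¹ᵁ (U : W'.Opens)) N).toMonoidHom.comp Φ) ∧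
      ∀ σN : W'.presheaf.stalk (g.base y') →+* N,
        σN.comp (W'.presheaf.germ (U : W'.Opens) (g.base y') hy').hom =
          (algebraMap Γ(Z, g ⁻¹ᵁ (U : W'.Opens)) N).comp (algebraMap Γ(W', (U : W'.Opens)) _) →
        divisorialMonoid (Ideal.span {σN (W'.presheaf.germ (U : W'.Opens) (g.base y') hy' (∏ j, xs j))}) =
          IsUnit.submonoid N ⊔
            MonoidHom.mrange ((algebraMap Γ(Z, g ⁻¹ᵁ (U : W'.Opens)) N).toMonoidHom.comp Φ) := by
    intro y' hy' N _ _ _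
    have hw'U : g.base y' ∈ (U : W'.Opens) := hy'
    letI := W'.presheaf.algebra_section_stalk (⟨g.base y', hw'U⟩ : (U : W'.Opens))
    haveI := U.2.isLocalization_stalk ⟨g.base y', hw'U⟩
    haveI : IsRegularLocalRing (W'.presheaf.stalk (g.base y')) := hreg _
    have hcomap : ((hVaff.primeIdealOf ⟨y', hy'⟩).asIdeal).comap
        (algebraMap Γ(W', (U : W'.Opens)) Γ(Z, g ⁻¹ᵁ (U : W'.Opens))) =
        (U.2.primeIdealOf ⟨g.base y', hw'U⟩).asIdeal := by
      ext s
      rw [Ideal.mem_comap, halg, ← Scheme.Hom.appLE_eq_app]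
      exact mem_primeIdealOf_iff_of_stalkMap g U.2 hVaff le_rfl y' hy' s
    haveI : IsLocalization.AtPrime (W'.presheaf.stalk (g.base y'))
        (((hVaff.primeIdealOf ⟨y', hy'⟩).asIdeal).comap
          (algebraMap Γ(W', (U : W'.Opens)) Γ(Z, g ⁻¹ᵁ (U : W'.Opens)))) :=
      isLocalization_atPrime_of_eq _ _ hcomap
    have hmem' : ∀ s : Γ(W', (U : W'.Opens)), s ∈ ((hVaff.primeIdealOf ⟨y', hy'⟩).asIdeal).comap
        (algebraMap Γ(W', (U : W'.Opens)) Γ(Z, g ⁻¹ᵁ (U : W'.Opens))) ↔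
        ¬ IsUnit (W'.presheaf.germ (U : W'.Opens) (g.base y') hw'U s) := fun s => by
      rw [hcomap]; exact hmem𝔮 _ hw'U s
    have key := localChart_pointwise_orthant (O₀ := W'.presheaf.stalk w)
      (O := W'.presheaf.stalk (g.base y')) (N := N) p xs aU gs uw Bexp hA hwt₀' hprime hinj' t ht'
      hbir' Φ hΦ (U.2.primeIdealOf ⟨w, hwU⟩).asIdeal hx₀ hli₀ (hVaff.primeIdealOf ⟨y', hy'⟩).asIdeal
      (fun s σ hσ hmem => (hli_of_spread (D := fun j => (D j).1) hDE hDinj hB1 hw'U hE σ hσ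
        fun i => (hmem' (xs (σ i))).mp (hmem i)).2)
      (fun s σ hσ hJ => pointData_giraudNormalFormAt_of_pointwise hDE hDinj hB1 hB2 hw'U aU
        (hG' _ hw'U) σ hσ fun j => (hmem' (xs j)).symm.trans (hJ j))
    exact ⟨key.1, fun σN hσN => key.2 σN hσN⟩
  -- the chart record
  refine ⟨⟨⟨g ⁻¹ᵁ (U : W'.Opens), hVaff⟩, hyV, r, AddSubmonoid.nonneg (Fin r → ℤ), Φ,
    nonneg_fg, nonneg_saturated, span_nonneg_eq_top, fun 𝔓 _ => ?_, fun y' hy' => ?_⟩⟩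
  · -- Kato's condition at `𝔓`
    obtain ⟨⟨y', hy'⟩, hy'𝔓⟩ := exists_point_of_prime hVaff 𝔓
    have h𝔓 : (hVaff.primeIdealOf ⟨y', hy'⟩).asIdeal = 𝔓 := by rw [hy'𝔓]
    haveI : IsLocalization.AtPrime (Localization.AtPrime 𝔓) (hVaff.primeIdealOf ⟨y', hy'⟩).asIdeal :=
      isLocalization_atPrime_of_eq _ _ h𝔓
    rw [LogChart.isLogRegularAt_iff_isLogRegularLocal]
    exact (perPoint y' hy' (Localization.AtPrime 𝔓)).1
  · -- the stalk monoid at `y'`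
    letI := Z.presheaf.algebra_section_stalk (⟨y', hy'⟩ : g ⁻¹ᵁ (U : W'.Opens))
    haveI := hVaff.isLocalization_stalk ⟨y', hy'⟩
    have hσN : (g.stalkMap y').hom.comp (W'.presheaf.germ (U : W'.Opens) (g.base y') hy').hom =
        (algebraMap Γ(Z, g ⁻¹ᵁ (U : W'.Opens)) (Z.presheaf.stalk y')).comp
          (algebraMap Γ(W', (U : W'.Opens)) _) := by
      have := Scheme.Hom.germ_stalkMap g (U : W'.Opens) y' hy'
      rw [← CommRingCat.hom_comp, this, CommRingCat.hom_comp]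
      rfl
    have key := (perPoint y' hy' (Z.presheaf.stalk y')).2 (g.stalkMap y').hom hσN
    change chartStalkMonoid _ Φ y' hy' =
      divisorialMonoid (((E.map fun D => stalkIdeal D (g.base y')).prod).map (g.stalkMap y').hom)
    rw [pointData_divisorialMonoid (D := fun j => (D j).1) hDE hB1 hB2 hy' (g.stalkMap y').hom, key,
      chartStalkMonoid, MonoidHom.map_mrange]
    rfl

end Summit.ResolutionOfSingularities.ResolutionOfSingularities.Theorems.Picover.LocalChartSepWoundCentre

end
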